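import Literature.NumberTheory.Transcendental.TorsionNumCond
import Literature.NumberTheory.Transcendental.ClosingDichotomy
import Mathlib.Data.Nat.Prime.Infinite
import HarnessLib

/-!
# Baker's method on `M_κ`: the dichotomy theorem of the torsion case

Topic: `Literature/NumberTheory/Transcendental`. Plan item W4 (closing, torsion case, part 6)
of the unit `provefact-Literature.NumberTheory.Transcendental.H-b596640137`. The torsion
configuration left open by `ClosingDichotomy.dichotomy` / `NumCondFamily.dichotomy'` (obstruction
`K = 0`: a multiple `P₀·w` of the algebraic point `w ∈ 𝔟` is a period, `w` itself is not) is run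
through Baker's method once more, with Baker–Wüstholz's division-point device (*Logarithmic Forms
and Diophantine Geometry*, §6.8, p. 117): for a prime `ℓ` beyond the orbit bound of
`TorsionOrbit.exists_bound_forall_notMem_ker` and beyond `c·κ₃^n·n!` (`c` Philippon's constant),
the division point `v = w/ℓ ∈ 𝔟` is algebraic with torsion abelian part, its multiples `r·v`,
`0 < r < ℓ`, are not periods, the torsion engine (`NewPointsTorsion.engine₃`, Siegel rows at the
`P₀` points `s·w` only, periodicity, extrapolation; parameters from
`TorsionNumCond.admissibleParams₃_of_lt`) produces a form vanishing to high order along `𝔟` at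
`s·v`, `s ≤ nS`, and Philippon's zero estimate (`philippon1986_std`) an obstruction `K ≠ M_κ` with
`binom(T″+e,e)·card((Σ+K)/K)·D^{dim K} ≤ c·D^n`. The numerics exclude every `K` whose orbit has at
least `ℓ` elements, and every non-borderline `K`; an obstruction with a small orbit has a multiple
`r·v`, `0 < r < ℓ`, in `Lie K + ker`, which for `K = 0` would be a period — excluded. PROVED:

**`torsionDichotomy`** — modulo Philippon's zero estimate, for a semistable proper `ℚ̄`-rational
`𝔟`, `w ∈ 𝔟 ∩ AlgTors` with `P₀·w ∈ ker`, `w ∉ ker`, there is a connected algebraic subgroup datum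
`K` over `ℂ` with `0 ≠ Lie K ≠ Lie M_κ` which is BORDERLINE for `𝔟`
(`dim 𝔟·(n - dim 𝔨) = (dim 𝔟 - dim(𝔟 ∩ 𝔨))·n`). For a STABLE `𝔟` (no borderline proper non-zero
subgroup) this is a contradiction, which is how the Semistability Theorem is closed (sequel).

## References

* A. Baker, G. Wüstholz, *Logarithmic Forms and Diophantine Geometry*, CUP 2007, §6.8 (pp. 117–119).
* P. Philippon, *Lemmes de zéros dans les groupes algébriques commutatifs*, Bull. SMF 114 (1986), Thm. 2.1.
-/

noncomputable section

open Module Submodule Complex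
open scoped PeriodPair

namespace Literature.NumberTheory.Transcendental

namespace GaGmE

namespace Std

open LiePresentation

variable {β γ δ : Type} [Fintype β] [Fintype γ] [Fintype δ] [DecidableEq γ] [DecidableEq β] [DecidableEq δ]

/-- **The dichotomy theorem of the torsion case.** Let `Λ` have algebraic invariants and no CM,
`𝔟 ⊊ Lie M_κ` `ℚ̄`-rational and semistable, `w ∈ 𝔟` with `exp(w)` algebraic with torsion abelian
part, `P₀·w ∈ ker(exp)` for some `P₀ ≥ 1` but `w ∉ ker(exp)`. Assume Philippon's zero estimate.
Then there is a connected algebraic subgroup datum `K` over `ℂ` with `Lie K ≠ Lie M_κ`,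
`Lie K ≠ 0`, borderline for the semistability of `𝔟`.
[cite: BakerWustholz2007, §6.8 (pp. 117–119: division point γ = exp(u/ℓ), ord γ = ℓ ord γ', "ℓS'T^d ≫ D^n")] -/
theorem torsionDichotomy (hphil : philippon1986_std) (L : PeriodPair) (h₂ : IsAlgebraic ℚ L.g₂)
    (h₃ : IsAlgebraic ℚ L.g₃) (hCM : ¬ L.HasCM) (κM : δ → γ → Kbar)
    {𝔟 : Submodule ℂ (β ⊕ (γ ⊕ δ) → ℂ)} (hrat : IsKRational Kbar 𝔟) (h𝔟 : 𝔟 ≠ ⊤)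
    (hss : Semistable κM 𝔟) {w : β ⊕ (γ ⊕ δ) → ℂ} (hw𝔟 : w ∈ 𝔟) (hw : w ∈ AlgTors L κM)
    {P₀ : ℕ} (hP₀ : 0 < P₀) (hPw : (P₀ : ℂ) • w ∈ ker L κM) (hwker : w ∉ ker L κM) :
    ∃ K : SubgroupDataC β γ δ κM, K.tangent ≠ ⊤ ∧ K.tangent ≠ ⊥ ∧
      Module.finrank ℂ 𝔟 * (Fintype.card (β ⊕ (γ ⊕ δ)) - Module.finrank ℂ K.tangent) =
        (Module.finrank ℂ 𝔟 - Module.finrank ℂ ↥(𝔟 ⊓ K.tangent)) * Fintype.card (β ⊕ (γ ⊕ δ)) := by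
  classical
  set n := Fintype.card (β ⊕ (γ ⊕ δ)) with hn
  set d := Module.finrank ℂ 𝔟 with hd
  -- `0 < d < n`
  have hdlt : d < n := by
    have := Submodule.finrank_lt h𝔟; simpa [hn, hd] using this
  have hdpos : 0 < d := by
    by_contra h0
    have h0' : d = 0 := by omega
    have h𝔟0 : 𝔟 = ⊥ := Submodule.finrank_eq_zero.mp h0'
    have hw0 : w = 0 := by rw [h𝔟0, Submodule.mem_bot] at hw𝔟; exact hw𝔟
    exact hwker (by rw [hw0]; exact zero_mem_ker L κM)
  have hn1 : 1 ≤ n := by omega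
  -- Philippon's constant
  obtain ⟨c, hc, hZ⟩ := hphil L h₂ h₃ hCM β γ δ κM
  -- the orbit bound and the threshold for the prime `ℓ`
  obtain ⟨M₀, hM₀⟩ := exists_bound_forall_notMem_ker L κM hP₀ hPw hwker
  set Kc : ℝ := c * ((n * (2 * (4 * n) ^ d * (P₀ - 1 + 1)) : ℕ) : ℝ) ^ n * (n.factorial : ℝ) with hKc
  obtain ⟨ℓ, hℓge, hℓ⟩ := Nat.exists_infinite_primes (M₀ + ⌈Kc⌉₊ + 1)
  have hℓM₀ : M₀ < ℓ := by omega
  have hℓKc : Kc < ℓ := by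
    have h1 := Nat.le_ceil Kc
    have h2 : ((⌈Kc⌉₊ + 1 : ℕ) : ℝ) ≤ ℓ := by exact_mod_cast (show ⌈Kc⌉₊ + 1 ≤ ℓ by omega)
    push_cast at h2; linarith
  have hℓpos : 0 < ℓ := hℓ.pos
  have hℓ0 : (ℓ : ℂ) ≠ 0 := by exact_mod_cast hℓ.ne_zero
  -- the division point `v = w/ℓ`
  set v : β ⊕ (γ ⊕ δ) → ℂ := (ℓ : ℂ)⁻¹ • w with hv
  have hv𝔟 : v ∈ 𝔟 := Submodule.smul_mem _ _ hw𝔟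
  have hvAlg : v ∈ AlgTors L κM := inv_natCast_smul_mem_AlgTors L κM h₂ h₃ hw hℓpos
  have horbit : ∀ r : ℕ, 0 < r → r < ℓ → (r : ℂ) • v ∉ ker L κM := hM₀ ℓ hℓ hℓM₀
  -- the Baker datum at `v`
  obtain ⟨B, hBL, hBκ, hBv, hBdd, hBspan⟩ := exists_bakerData L h₂ h₃ κM hrat hvAlg
  have hBdd' : B.dd = d := hBdd
  have hddlt : B.dd < Fintype.card (β ⊕ (γ ⊕ δ)) := by rw [hBdd', ← hn]; exact hdlt
  -- the parameters of the torsion engine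
  have hspc : c * ((Fintype.card (β ⊕ (γ ⊕ δ)) * (2 * (4 * Fintype.card (β ⊕ (γ ⊕ δ))) ^ B.dd * (P₀ - 1 + 1)) : ℕ) : ℝ) ^
      Fintype.card (β ⊕ (γ ⊕ δ)) * ((Fintype.card (β ⊕ (γ ⊕ δ))).factorial : ℝ) < ℓ := by
    rw [hBdd', ← hn]; exact hℓKc
  obtain ⟨D', T, S₀, S, T'', R, hT, hD', hS, hℓS, hpq, hR0, hR, hnum, hineq⟩ :=
    B.admissibleParams₃_of_lt hddlt hc (P₀ - 1) hspc
  -- periodicity datum: `(ℓ P₀)·v = P₀·w ∈ ker`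
  have hper : ((ℓ * (P₀ - 1 + 1) : ℕ) : ℂ) • B.v ∈ ker B.L B.κM := by
    rw [hBv, hBL, hBκ, hv, smul_smul, show P₀ - 1 + 1 = P₀ by omega]
    have e : ((ℓ * P₀ : ℕ) : ℂ) * (ℓ : ℂ)⁻¹ = (P₀ : ℂ) := by push_cast; field_simp
    rw [e]; exact hPw
  -- run the torsion engine
  have hvspan : B.v ∈ B.bSpan := by
    show B.v ∈ Submodule.span ℂ (Set.range B.xs)
    rw [hBspan, hBv]; exact hv𝔟
  obtain ⟨P, hP, hne, hvan⟩ := B.engine₃ hvspan ℓ D' T (P₀ - 1) S₀ (n * S) (n * T'' + 1) R hℓpos hT hpq hper hR0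
    (by rw [hn]; exact hR) (by rw [hn]; exact hnum)
  -- Philippon's zero estimate
  have hD1 : 1 ≤ n * D' := Nat.one_le_iff_ne_zero.mpr (Nat.mul_ne_zero (by omega) (by omega))
  have hvan' : ∀ s : ℕ, s ≤ n * S → VanishesAlong 𝔟 (thetaEval L κM P) ((s : ℂ) • v) (n * T'' + 1) := by
    intro s hs
    have := hvan s hs
    rwa [show B.bSpan = 𝔟 from hBspan, hBL, hBκ, hBv] at this
  have hne' : ∃ w', thetaEval L κM P w' ≠ 0 := by rwa [hBL, hBκ] at hne
  have hP' : P.IsHomogeneous (n * D') := by rw [hn]; exact hP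
  obtain ⟨K, ⟨w₀, hw₀⟩, hK⟩ := hZ 𝔟 v P (n * D') S T'' (by rw [← hd]; exact hdpos) hD1 hS hP' hne' hvan'
  -- `K ≠ M_κ`
  have hKtop : K.tangent ≠ ⊤ := by
    intro htop
    obtain ⟨w', hw'⟩ := hne'
    apply hw'
    have := hw₀ (w' - w₀) (by rw [htop]; trivial)
    simpa using this
  have hm : Module.finrank ℂ K.tangent < n := by
    have := Submodule.finrank_lt hKtop; simpa [hn] using this
  -- the index inequality and the numerics
  have hidx := hss.index_le κM hrat K hKtop
  set e := Module.finrank ℂ 𝔟 - Module.finrank ℂ ↥(𝔟 ⊓ K.tangent) with he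
  set m := Module.finrank ℂ K.tangent with hm'
  rw [← hn, ← hd] at hidx
  obtain ⟨hfull, hstrict⟩ := hineq e m hm (by rw [hBdd']; exact hidx)
  have hD0 : (0 : ℝ) < ((n * D' : ℕ) : ℝ) := by exact_mod_cast hD1
  have horb1 : (1 : ℝ) ≤ orbitCard L κM K v S := by exact_mod_cast one_le_orbitCard L κM K v S
  -- orbit dichotomy at the threshold `ℓ`
  by_cases horb : ℓ ≤ orbitCard L κM K v S
  · -- large orbit: the numerics contradict Philippon
    exfalso
    have horb' : (ℓ : ℝ) ≤ orbitCard L κM K v S := by exact_mod_cast horb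
    have h2 : (Nat.choose (T'' + e) e : ℝ) * (ℓ : ℝ) * ((n * D' : ℕ) : ℝ) ^ m ≤
        (Nat.choose (T'' + e) e : ℝ) * (orbitCard L κM K v S : ℝ) * ((n * D' : ℕ) : ℝ) ^ m := by
      have hch : (0 : ℝ) ≤ (Nat.choose (T'' + e) e : ℝ) := Nat.cast_nonneg _
      have hpow : (0 : ℝ) ≤ ((n * D' : ℕ) : ℝ) ^ m := by positivity
      exact mul_le_mul_of_nonneg_right (mul_le_mul_of_nonneg_left horb' hch) hpow
    rw [← hn] at hK hfull
    push_cast at hK hfull h2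
    linarith
  · -- small orbit: a multiple `r·v`, `0 < r < ℓ`, lies in `Lie K + ker`
    have hsmall : ∃ r : ℕ, 0 < r ∧ r < ℓ ∧ (r : ℂ) • v ∈ preimageSubgroup L κM K := by
      by_contra hno
      push Not at hno
      exact horb (le_orbitCard L κM K v hℓS fun r hr hrℓ => hno r hr hrℓ)
    obtain ⟨r, hr, hrℓ, hrmem⟩ := hsmall
    -- `K ≠ 0`: otherwise `r·v` would be a period
    have hKbot : K.tangent ≠ ⊥ := by
      intro hbot
      exact horbit r hr hrℓ ((mem_preimageSubgroup_of_tangent_eq_bot L κM hbot).mp hrmem)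
    refine ⟨K, hKtop, hKbot, ?_⟩
    -- `K` must be borderline
    change d * (n - m) = e * n
    by_contra hneq
    have hlt : d * (n - m) < e * n := lt_of_le_of_ne hidx hneq
    have h1 := hstrict (by rw [hBdd']; exact hlt)
    have h2 : (Nat.choose (T'' + e) e : ℝ) * ((n * D' : ℕ) : ℝ) ^ m ≤
        (Nat.choose (T'' + e) e : ℝ) * (orbitCard L κM K v S : ℝ) * ((n * D' : ℕ) : ℝ) ^ m := by
      have hch : (0 : ℝ) ≤ (Nat.choose (T'' + e) e : ℝ) := Nat.cast_nonneg _
      have hpow : (0 : ℝ) ≤ ((n * D' : ℕ) : ℝ) ^ m := by positivity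
      rw [show (Nat.choose (T'' + e) e : ℝ) * ((n * D' : ℕ) : ℝ) ^ m =
        (Nat.choose (T'' + e) e : ℝ) * 1 * ((n * D' : ℕ) : ℝ) ^ m from by ring]
      exact mul_le_mul_of_nonneg_right (mul_le_mul_of_nonneg_left horb1 hch) hpow
    rw [← hn] at hK h1
    push_cast at hK h1 h2
    linarith

end Std

end GaGmE

end Literature.NumberTheory.Transcendental

end
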